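import Literature.NumberTheory.LFunctions.ConreyIwaniec2002CircleMethodExpansion
import Literature.NumberTheory.LFunctions.ConreyIwaniec2002CircleMethodDissection
import HarnessLib

/-!
# Conrey–Iwaniec (2002), proof of Theorem 4.1: the Kloosterman step for one modulus `c`

B. Conrey, H. Iwaniec, *Spacing of zeros of Hecke `L`-functions and the class number problem*,
Acta Arith. 103 (2002) 259–312, §4, proof of Theorem 4.1 [held text `paper:arxiv-math_0111012`,
p0011:L1–45]: "Inserting this into (4.12) and changing the order of summation … incomplete
Kloosterman sums for which Weil's bound yields (4.14). We apply this result with `l = l_{m₁} − l_{m₂}`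
for all terms, except for `m₁ = m₂ = 0` in the range `|α| < c^{-1}(c + C)^{-1}`, i.e. when the
interval (4.13) has length `c`. We derive for any `α`:
`V_c(α) = |ĝ(α)p(c)|²{Σ*_{d ∈ I} e(−ah/c) + …} + O(A²(h,c)^{1/2}c^{3/2}τ(c)(log C)(|ĝ(α)| +
Σ_1^∞τ(m)|ĝ_m(α)|)(Σ_1^∞τ(m)|ĝ_m(α)|))` by (4.4), (4.7) and (4.14). In the leading term we get
exact Ramanujan sum (4.15)."

For the assembly of Theorem 4.1 (registered stub S3b3 `stub_circle_assembly` of SKELETON S3, cell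
`landau-siegel/ls-inputs`, line `theta-circle-method`) this file proves, from the registered input
`IncompleteKloostermanBound K₀` (4.14), the datum `IsVoronoiDatum` and the kernel bound (4.5):

* `norm_kloosterman_nat_le` — (4.14) over `d ∈ (y₁, y₂] ⊂ ℕ`, `y₂ − y₁ ≤ c`;
* `norm_sum_fourierChar_inv_sub_ramanujanSum_le` — the `d`-sum of the leading coefficient is the
  complete Ramanujan sum `r_c(h)` when `I = (C, c + C]`, and within (4.14) of it otherwise;
* `norm_sum_shifted_sub_main_le` — for one modulus `1 ≤ c ≤ C = 2√(qX)`, one `|α| ≤ (cC)^{-1}`, one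
  interval `I` of length `≤ c` and either sign `s = ±1` (the two halves `α ≷ 0` of (4.11)):
  `‖Σ_{d ∈ I} F(s(a_d/c − α)) − e(shα)p(c)²ĝ₁(sα)conj((ḡ₂)^(sα))Σ_{d ∈ I}e(−sha_d/c)‖ ≤
  W_c·((A/c)(|ĝ₁| + |(ḡ₂)^|)M + M²)`, `F(θ) = e(−hθ)S₁(θ)S̄₂(θ)`, `a_d = d̄`,
  `W_c = K₀τ(c)(h,c)^{1/2}c^{1/2}(1 + log c)`, `M = ABC·K₅₄²` — print's display above with the
  absolute constants made explicit (product form: `|u_c(a)|² = 1` removes the `a`-dependence, so no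
  residue classes modulo `q` are needed and the factor `q` of (4.14)/(4.17) does not arise).

## References

* [ConreyIwaniec2002] B. Conrey, H. Iwaniec, Acta Arith. 103 (2002) 259–312, arXiv:math/0111012:
  §4 (4.3)–(4.7), (4.12)–(4.15), proof of Theorem 4.1.
-/

noncomputable section

open scoped FourierTransform ComplexConjugate
open Complex MeasureTheory Set Finset

namespace Literature.NumberTheory.LFunctions

namespace ConreyIwaniec2002

namespace CircleMethod

open Literature.NumberTheory.Sieve (ramanujanSum)

/-- `e(x)e(y) = e(x + y)` in `ℂ`. [folklore] -/
private theorem fourierChar_mul_eq (x y : ℝ) : (𝐞 x : ℂ) * (𝐞 y : ℂ) = (𝐞 (x + y) : ℂ) := by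
  rw [← Circle.coe_mul, ← AddChar.map_add_eq_mul]

/-- `|e(x)| = 1` in `ℂ`. [folklore] -/
private theorem norm_fourierChar_eq (x : ℝ) : ‖(𝐞 x : ℂ)‖ = 1 := Circle.norm_coe _

/-- `conj e(x) = e(−x)`. [folklore] -/
private theorem conj_fourierChar_eq (x : ℝ) : conj ((𝐞 x : ℂ)) = (𝐞 (-x) : ℂ) := by
  rw [← Circle.coe_inv_eq_conj, AddChar.map_neg_eq_inv]

/-! ### (4.14) over an interval of naturals -/

/-- **(4.14) for `d ∈ (y₁, y₂] ⊂ ℕ`, `y₂ − y₁ ≤ c`**: from `IncompleteKloostermanBound K₀`,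
`‖Σ_{y₁ < d ≤ y₂, (c,d)=1} e((l·d + t·d̄)/c)‖ ≤ K₀τ(c)(t,c)^{1/2}c^{1/2}(1 + log c)`
(`d̄ = d⁻¹ mod c`). [cite: ConreyIwaniec2002, §4 (4.14)] -/
theorem norm_kloosterman_nat_le {K₀ : ℝ} (hKl : IncompleteKloostermanBound K₀) {c : ℕ} (hc : 1 ≤ c)
    (l t : ℤ) {y₁ y₂ : ℕ} (hy : y₁ ≤ y₂) (hlen : y₂ ≤ y₁ + c) :
    ‖∑ d ∈ (Finset.Ioc y₁ y₂).filter (fun d ↦ Nat.Coprime c d),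
        (𝐞 (((l * d + t * (((d : ZMod c)⁻¹).val : ℤ) : ℤ) : ℝ) / c) : ℂ)‖ ≤
      K₀ * (Nat.divisors c).card * Real.sqrt (Int.gcd t c) * Real.sqrt c * (1 + Real.log c) := by
  have h := hKl c hc l t y₁ y₂ (by exact_mod_cast hy) (by linarith [show (y₂ : ℤ) ≤ y₁ + c by exact_mod_cast hlen])
  convert h using 2
  refine Finset.sum_nbij' (fun d : ℕ ↦ (d : ℤ)) (fun z : ℤ ↦ z.toNat) ?_ ?_ ?_ ?_ ?_
  · intro d hd
    simp only [Finset.mem_filter, Finset.mem_Ioc] at hd ⊢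
    refine ⟨⟨by exact_mod_cast hd.1.1, by exact_mod_cast hd.1.2⟩, ?_⟩
    rw [Int.gcd_natCast_natCast, Nat.gcd_comm]
    exact hd.2
  · intro z hz
    simp only [Finset.mem_filter, Finset.mem_Ioc] at hz ⊢
    have hz0 : 0 ≤ z := le_trans (by positivity) hz.1.1.le
    refine ⟨⟨by omega, by omega⟩, ?_⟩
    have : Int.gcd z c = Nat.gcd z.toNat c := by
      conv_lhs => rw [← Int.toNat_of_nonneg hz0]
      exact Int.gcd_natCast_natCast _ _
    rw [Nat.coprime_iff_gcd_eq_one, Nat.gcd_comm, ← this]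
    exact hz.2
  · intro d _
    simp
  · intro z hz
    simp only [Finset.mem_filter, Finset.mem_Ioc] at hz
    have hz0 : 0 ≤ z := le_trans (by positivity) hz.1.1.le
    exact Int.toNat_of_nonneg hz0
  · intro d _
    simp only [Int.cast_natCast]

/-! ### The leading coefficient: complete and incomplete Ramanujan sums -/

/-- **The `d`-sum of the leading term**: for `c ≥ 1`, `t ∈ ℤ` and `C ≤ y ≤ C + c`,
`Σ_{C < d ≤ y, (c,d)=1} e(t d̄/c)` equals the Ramanujan sum `r_c(t)` when `y = C + c` ("`I = (C, c+C]`
has length exactly `c`"), and otherwise differs from it by an incomplete Kloosterman sum of length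
`< c`, bounded by (4.14): `‖Σ_{C < d ≤ y} e(t d̄/c) − r_c(t)‖ ≤ [y < C + c]·K₀τ(c)(t,c)^{1/2}c^{1/2}(1 + log c)`.
[cite: ConreyIwaniec2002, §4 (4.13)–(4.15)] -/
theorem norm_sum_fourierChar_inv_sub_ramanujanSum_le {K₀ : ℝ} (hKl : IncompleteKloostermanBound K₀)
    {c : ℕ} (hc : 1 ≤ c) (t : ℤ) {C y : ℕ} (hCy : C ≤ y) (hy : y ≤ C + c) :
    ‖(∑ d ∈ (Finset.Ioc C y).filter (fun d ↦ Nat.Coprime c d),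
        (𝐞 ((t * (((d : ZMod c)⁻¹).val : ℤ) : ℤ) / c) : ℂ)) - ramanujanSum c t‖ ≤
      (if y < C + c then 1 else 0) * (K₀ * (Nat.divisors c).card * Real.sqrt (Int.gcd t c) *
        Real.sqrt c * (1 + Real.log c)) := by
  classical
  -- the complete sum over `(C, C + c]`
  have hfull : ∑ d ∈ (Finset.Ioc C (c + C)).filter (fun d ↦ Nat.Coprime c d),
      (𝐞 ((t * (((d : ZMod c)⁻¹).val : ℤ) : ℤ) / c) : ℂ) = ramanujanSum c t := by
    rw [← sum_fourierChar_inv_eq_ramanujanSum hc C t]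
    refine Finset.sum_congr rfl fun d _ ↦ ?_
    congr 2
    push_cast
    ring
  -- split `(C, C + c] = (C, y] ∪ (y, C + c]`
  have hsplit : (Finset.Ioc C (c + C)).filter (fun d ↦ Nat.Coprime c d) =
      (Finset.Ioc C y).filter (fun d ↦ Nat.Coprime c d) ∪
        (Finset.Ioc y (c + C)).filter (fun d ↦ Nat.Coprime c d) := by
    rw [← Finset.filter_union, Finset.Ioc_union_Ioc_eq_Ioc hCy (by omega)]
  have hdisj : Disjoint ((Finset.Ioc C y).filter (fun d ↦ Nat.Coprime c d))
      ((Finset.Ioc y (c + C)).filter (fun d ↦ Nat.Coprime c d)) :=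
    Finset.disjoint_filter_filter (Finset.Ioc_disjoint_Ioc_of_le le_rfl)
  rw [← hfull, hsplit, Finset.sum_union hdisj, sub_add_cancel_left, norm_neg]
  by_cases hlt : y < C + c
  · rw [if_pos hlt, one_mul]
    have := norm_kloosterman_nat_le hKl hc 0 t (show y ≤ c + C by omega) (by omega)
    simpa using this
  · rw [if_neg hlt, zero_mul]
    have hyc : y = c + C := by omega
    rw [hyc, Finset.Ioc_self, Finset.filter_empty, Finset.sum_empty, norm_zero]

/-! ### The estimate for one modulus, one `α` and one interval -/

/-- `(s·d̄)(s·d) ≡ 1 (mod c)` for `d` prime to `c` and `s = ±1` (`d̄ = d⁻¹ mod c`). [folklore] -/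
private theorem sign_inv_mul_sign_modEq {c : ℕ} (hc : 1 ≤ c) {d : ℕ} (hd : Nat.Coprime c d)
    {s : ℤ} (hs : s = 1 ∨ s = -1) :
    (s * (((d : ZMod c)⁻¹).val : ℤ)) * (s * d) ≡ 1 [ZMOD c] := by
  haveI : NeZero c := ⟨by omega⟩
  have hs2 : s * s = 1 := by rcases hs with rfl | rfl <;> norm_num
  have hu : IsUnit ((d : ZMod c)) := (ZMod.isUnit_iff_coprime d c).mpr hd.symm
  rw [show (s * (((d : ZMod c)⁻¹).val : ℤ)) * (s * d) = (s * s) * ((((d : ZMod c)⁻¹).val : ℤ) * d)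
    by ring, hs2, one_mul]
  rw [← ZMod.intCast_eq_intCast_iff]
  push_cast
  rw [ZMod.natCast_zmod_val, ZMod.inv_mul_of_unit _ hu]

/-- **The Kloosterman step for one modulus `c`, one `α`, one interval `I` and one sign `s = ±1`.**
With `S₁(θ) = Σλ(n)g₁(n)e(nθ)`, `S₂(θ) = Σλ(n)conj(g₂(n))e(nθ)`, `F(θ) = e(−hθ)S₁(θ)S̄₂(θ)`, the
points `θ_d = s(a_d/c − α)` (`a_d = d̄`), `1 ≤ c ≤ C = 2√(qX)`, `|α| ≤ (cC)^{-1}`,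
`I = {y₁ < d ≤ y₂, (c,d) = 1}`, `y₂ − y₁ ≤ c`:
`‖Σ_{d ∈ I} F(θ_d) − e(shα)p(c)²ĝ₁(sα)conj((ḡ₂)^(sα))Σ_{d ∈ I}e(−sha_d/c)‖ ≤
 W_c·((A/c)(|ĝ₁(sα)| + |(ḡ₂)^(sα)|)M + M²)` with `W_c = K₀τ(c)(h,c)^{1/2}c^{1/2}(1 + log c)` and
`M = ABC·K₅₄²` — (4.3) at each `a_d/c`, `|u_c(a)|² = 1`, and (4.14) for each pair `(m₁, m₂)`
("changing the order of summation"). [cite: ConreyIwaniec2002, §4, proof of Theorem 4.1 ((4.12)–(4.15))] -/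
theorem norm_sum_shifted_sub_main_le
    {A B K₀ : ℝ} {q : ℕ} {lam : ℕ → ℂ} {kf : ℕ → ℕ → ℝ → ℂ} {p : ℕ → ℝ} {u : ℕ → ℤ → ℂ}
    {φ : ℕ → ℕ → ℂ} {l : ℕ → ℕ → ℤ}
    (hV : IsVoronoiDatum A lam kf p u φ l) (hK : KernelFourierBound q B kf)
    (hKl : IncompleteKloostermanBound K₀)
    {X : ℝ} (hX : 1 / 2 ≤ X) {g₁ g₂ : ℝ → ℂ} (hg₁ : IsBumpOn X g₁) (hg₂ : IsBumpOn X g₂)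
    (h : ℕ) {c : ℕ} (hc : 1 ≤ c) (hcC : (c : ℝ) ≤ 2 * Real.sqrt (q * X))
    {α : ℝ} (hα : |α| ≤ 1 / (c * (2 * Real.sqrt (q * X))))
    {s : ℤ} (hs : s = 1 ∨ s = -1) {y₁ y₂ : ℕ} (hy : y₁ ≤ y₂) (hlen : y₂ ≤ y₁ + c)
    (F : ℝ → ℂ)
    (hF : ∀ θ : ℝ, F θ = (𝐞 (-(h * θ)) : ℂ) *
        ((∑ n ∈ Finset.Icc 1 ⌊2 * X⌋₊, lam n * g₁ n * (𝐞 (n * θ) : ℂ)) *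
          conj (∑ n ∈ Finset.Icc 1 ⌊2 * X⌋₊, lam n * conj (g₂ n) * (𝐞 (n * θ) : ℂ)))) :
    ‖(∑ d ∈ (Finset.Ioc y₁ y₂).filter (fun d ↦ Nat.Coprime c d),
        F (s * ((((d : ZMod c)⁻¹).val : ℝ) / c - α))) -
      (𝐞 (s * h * α) : ℂ) * ((p c : ℂ) ^ 2 * (𝓕 g₁ (s * α) * conj (𝓕 (fun x ↦ conj (g₂ x)) (s * α)))) *
        ∑ d ∈ (Finset.Ioc y₁ y₂).filter (fun d ↦ Nat.Coprime c d),
          (𝐞 (((-(s * h) * (((d : ZMod c)⁻¹).val : ℤ) : ℤ) : ℝ) / c) : ℂ)‖ ≤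
      (K₀ * (Nat.divisors c).card * Real.sqrt (Nat.gcd h c) * Real.sqrt c * (1 + Real.log c)) *
        ((A / c) * (‖𝓕 g₁ (s * α)‖ + ‖𝓕 (fun x ↦ conj (g₂ x)) (s * α)‖) *
            (A * B * (2 * Real.sqrt (q * X)) * (∑' n : ℕ, (n : ℝ) ^ (-(5 / 4 : ℝ))) ^ 2) +
          (A * B * (2 * Real.sqrt (q * X)) * (∑' n : ℕ, (n : ℝ) ^ (-(5 / 4 : ℝ))) ^ 2) ^ 2) := by
  classical
  -- abbreviations
  set I : Finset ℕ := (Finset.Ioc y₁ y₂).filter (fun d ↦ Nat.Coprime c d) with hI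
  set C : ℝ := 2 * Real.sqrt (q * X) with hCdef
  set M : ℝ := A * B * C * (∑' n : ℕ, (n : ℝ) ^ (-(5 / 4 : ℝ))) ^ 2 with hM
  set W : ℝ := K₀ * (Nat.divisors c).card * Real.sqrt (Nat.gcd h c) * Real.sqrt c *
    (1 + Real.log c) with hW
  set ad : ℕ → ℤ := fun d ↦ (((d : ZMod c)⁻¹).val : ℤ) with had
  set β : ℝ := s * α with hβ
  set g₂c : ℝ → ℂ := fun x ↦ conj (g₂ x) with hg₂c
  have hg₂' : IsBumpOn X g₂c := isBumpOn_conj hg₂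
  have hc' : (0 : ℝ) < c := by exact_mod_cast hc
  have hs1 : |(s : ℝ)| = 1 := by rcases hs with rfl | rfl <;> simp
  have hs2 : (s : ℝ) * s = 1 := by rcases hs with rfl | rfl <;> simp
  have hβα : |β| ≤ 1 / (c * C) := by rw [hβ, abs_mul, hs1, one_mul]; exact hα
  -- the sequences `Φ_j(m) = φ_c(m+1) ĝ_{j,m+1}(β)`, the phases and the weights
  set Φ₁ : ℕ → ℂ := fun m ↦ φ c (m + 1) * 𝓕 (fun x ↦ g₁ x * kf c (m + 1) x) β with hΦ₁
  set Φ₂ : ℕ → ℂ := fun m ↦ φ c (m + 1) * 𝓕 (fun x ↦ g₂c x * kf c (m + 1) x) β with hΦ₂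
  set ε : ℕ → ℕ → ℂ := fun m d ↦ (𝐞 ((((s * d) * l c (m + 1) : ℤ) : ℝ) / c) : ℂ) with hε
  set w : ℕ → ℂ := fun d ↦ (𝐞 (((-(s * h) * ad d : ℤ) : ℝ) / c) : ℂ) with hw
  obtain ⟨hΦ₁s, hΦ₁le⟩ := summable_norm_coeff_mul_fourier hV hK hX hg₁ hc hcC hβα
  obtain ⟨hΦ₂s, hΦ₂le⟩ := summable_norm_coeff_mul_fourier hV hK hX hg₂' hc hcC hβα
  have hεn : ∀ m d, ‖ε m d‖ ≤ 1 := fun m d ↦ by rw [hε, norm_fourierChar_eq]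
  have hwn : ∀ d, ‖w d‖ = 1 := fun d ↦ by rw [hw, norm_fourierChar_eq]
  -- data at level `c`
  obtain ⟨hp0, hpA, -, hrest⟩ := hV c hc
  have hM0 : 0 ≤ M := le_trans (tsum_nonneg fun _ ↦ norm_nonneg _) hΦ₁le
  -- the incomplete Kloosterman sums (4.14): all the `d`-sums that occur are bounded by `W`
  have hgcd : ∀ t : ℤ, (t = s * h ∨ t = -(s * h)) → Int.gcd t c = Nat.gcd h c := by
    intro t ht
    have : t.natAbs = h := by
      rcases ht with rfl | rfl <;> rcases hs with rfl | rfl <;> simp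
    rw [Int.gcd, this, Int.natAbs_natCast]
  have hKlW : ∀ (l' t : ℤ), (t = s * h ∨ t = -(s * h)) →
      ‖∑ d ∈ I, (𝐞 (((l' * d + t * ad d : ℤ) : ℝ) / c) : ℂ)‖ ≤ W := by
    intro l' t ht
    have := norm_kloosterman_nat_le hKl hc l' t hy hlen
    rw [hgcd t ht] at this
    exact this
  have hW1 : ∀ m, ‖∑ d ∈ I, w d * ε m d‖ ≤ W := by
    intro m
    have := hKlW (s * l c (m + 1)) (-(s * h)) (Or.inr rfl)
    refine le_of_eq_of_le ?_ this
    congr 1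
    refine Finset.sum_congr rfl fun d _ ↦ ?_
    rw [hw, hε, fourierChar_mul_eq]
    congr 2
    push_cast
    ring
  have hW2 : ∀ m, ‖∑ d ∈ I, w d * conj (ε m d)‖ ≤ W := by
    intro m
    have := hKlW (-(s * l c (m + 1))) (-(s * h)) (Or.inr rfl)
    refine le_of_eq_of_le ?_ this
    congr 1
    refine Finset.sum_congr rfl fun d _ ↦ ?_
    rw [hw, hε, conj_fourierChar_eq, fourierChar_mul_eq]
    congr 2
    push_cast
    ring
  have hW3 : ∀ m n, ‖∑ d ∈ I, w d * (ε m d * conj (ε n d))‖ ≤ W := by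
    intro m n
    have := hKlW (s * (l c (m + 1) - l c (n + 1))) (-(s * h)) (Or.inr rfl)
    refine le_of_eq_of_le ?_ this
    congr 1
    refine Finset.sum_congr rfl fun d _ ↦ ?_
    rw [hw, hε, conj_fourierChar_eq, fourierChar_mul_eq, fourierChar_mul_eq]
    congr 2
    push_cast
    ring
  -- the three exchanged sums
  have hT₁ : ‖∑ d ∈ I, w d * ∑' m, Φ₁ m * ε m d‖ ≤ (∑' m, ‖Φ₁ m‖) * W :=
    norm_sum_mul_tsum_le I w ε Φ₁ hΦ₁s hεn hW1
  have hT₂ : ‖∑ d ∈ I, w d * conj (∑' m, Φ₂ m * ε m d)‖ ≤ (∑' m, ‖Φ₂ m‖) * W := by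
    have hconj : ∀ d, conj (∑' m, Φ₂ m * ε m d) = ∑' m, conj (Φ₂ m) * conj (ε m d) := by
      intro d
      rw [Complex.conj_tsum]
      exact tsum_congr fun m ↦ map_mul _ _ _
    simp_rw [hconj]
    have hΦ₂' : Summable (fun m ↦ ‖conj (Φ₂ m)‖) := by
      simp only [Complex.norm_conj]; exact hΦ₂s
    have := norm_sum_mul_tsum_le I w (fun m d ↦ conj (ε m d)) (fun m ↦ conj (Φ₂ m)) hΦ₂'
      (fun m d ↦ by rw [Complex.norm_conj]; exact hεn m d) hW2
    simpa [Complex.norm_conj] using this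
  have hT₃ : ‖∑ d ∈ I, w d * ((∑' m, Φ₁ m * ε m d) * conj (∑' n, Φ₂ n * ε n d))‖ ≤
      (∑' m, ‖Φ₁ m‖) * (∑' n, ‖Φ₂ n‖) * W :=
    norm_sum_mul_tsum_mul_conj_tsum_le I w ε Φ₁ Φ₂ hΦ₁s hΦ₂s hεn hW3
  -- (4.3) at each point `s(a_d/c - α)`: `S_j = u (p ĝ_j(β) + T_j(d))`
  have hpt : ∀ d : ℕ, (s : ℝ) * ((((d : ZMod c)⁻¹).val : ℝ) / c - α) =
      ((s * ad d : ℤ) : ℝ) / c - β := by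
    intro d; rw [had, hβ]; push_cast; ring
  have hexp : ∀ (g : ℝ → ℂ), IsBumpOn X g → ∀ d ∈ I,
      (∑ n ∈ Finset.Icc 1 ⌊2 * X⌋₊, lam n * g n *
          (𝐞 (n * ((s : ℝ) * ((((d : ZMod c)⁻¹).val : ℝ) / c - α))) : ℂ)) =
        u c (s * ad d) * ((p c : ℂ) * 𝓕 g β +
          ∑' m, (φ c (m + 1) * 𝓕 (fun x ↦ g x * kf c (m + 1) x) β) * ε m d) := by
    intro g hg d hd
    rw [hI, Finset.mem_filter] at hd
    have hVd := hasSum_voronoi_fourier hV hX hg hc (sign_inv_mul_sign_modEq hc hd.2 hs) β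
    have hVd' : HasSum (fun m : ℕ ↦ u c (s * ad d) *
        ((φ c (m + 1) * 𝓕 (fun x ↦ g x * kf c (m + 1) x) β) * ε m d))
        ((∑ n ∈ Finset.Icc 1 ⌊2 * X⌋₊, lam n * g n *
            (𝐞 (n * (((s * ad d : ℤ) : ℝ) / c - β)) : ℂ)) - u c (s * ad d) * p c * 𝓕 g β) := by
      refine hVd.congr_fun fun m ↦ ?_
      rw [hε]
      push_cast
      ring
    have heq := hVd'.tsum_eq
    rw [tsum_mul_left] at heq
    simp_rw [hpt d]
    rw [mul_add, heq]
    ring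
  -- `|u|² = 1`
  have hu : ∀ d ∈ I, u c (s * ad d) * conj (u c (s * ad d)) = 1 := by
    intro d hd
    rw [hI, Finset.mem_filter] at hd
    obtain ⟨hnorm, -⟩ := hrest (s * ad d) (s * d) (sign_inv_mul_sign_modEq hc hd.2 hs)
    rw [Complex.mul_conj, Complex.normSq_eq_norm_sq, hnorm]
    norm_num
  -- the value of `F` at each point
  set P₁ : ℂ := (p c : ℂ) * 𝓕 g₁ β with hP₁
  set Q : ℂ := (p c : ℂ) * conj (𝓕 g₂c β) with hQ
  set T₁ : ℕ → ℂ := fun d ↦ ∑' m, Φ₁ m * ε m d with hT₁def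
  set T₂ : ℕ → ℂ := fun d ↦ ∑' m, Φ₂ m * ε m d with hT₂def
  have hFd : ∀ d ∈ I, F (s * ((((d : ZMod c)⁻¹).val : ℝ) / c - α)) =
      (𝐞 (s * h * α) : ℂ) * (w d * ((P₁ + T₁ d) * (Q + conj (T₂ d)))) := by
    intro d hd
    rw [hF, hexp g₁ hg₁ d hd]
    have h2 := hexp g₂c hg₂' d hd
    simp only [hg₂c] at h2
    rw [h2, map_mul, map_add, map_mul, Complex.conj_ofReal]
    have hph : (𝐞 (-(h * ((s : ℝ) * ((((d : ZMod c)⁻¹).val : ℝ) / c - α)))) : ℂ) =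
        (𝐞 (s * h * α) : ℂ) * w d := by
      rw [hw, fourierChar_mul_eq]; congr 2; rw [had]; push_cast; ring
    rw [hph]
    have hu' := hu d hd
    simp only [hP₁, hQ, hT₁def, hT₂def, hΦ₁, hΦ₂, hg₂c]
    linear_combination (𝐞 (s * h * α) : ℂ) * w d *
      (((p c : ℂ) * 𝓕 g₁ β + ∑' m, φ c (m + 1) * 𝓕 (fun x ↦ g₁ x * kf c (m + 1) x) β * ε m d) *
        ((p c : ℂ) * conj (𝓕 (fun x ↦ conj (g₂ x)) β) +
          conj (∑' m, φ c (m + 1) * 𝓕 (fun x ↦ conj (g₂ x) * kf c (m + 1) x) β * ε m d))) * hu'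
  -- sum over `d` and subtract the leading term
  have hdiff : (∑ d ∈ I, F (s * ((((d : ZMod c)⁻¹).val : ℝ) / c - α))) -
      (𝐞 (s * h * α) : ℂ) * ((p c : ℂ) ^ 2 * (𝓕 g₁ β * conj (𝓕 g₂c β))) * ∑ d ∈ I, w d =
      (𝐞 (s * h * α) : ℂ) * (P₁ * ∑ d ∈ I, w d * conj (T₂ d) + Q * ∑ d ∈ I, w d * T₁ d +
        ∑ d ∈ I, w d * (T₁ d * conj (T₂ d))) := by
    rw [Finset.mul_sum, Finset.mul_sum, Finset.mul_sum, ← Finset.sum_sub_distrib,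
      ← Finset.sum_add_distrib, ← Finset.sum_add_distrib, Finset.mul_sum]
    refine Finset.sum_congr rfl fun d hd ↦ ?_
    rw [hFd d hd, hP₁, hQ]
    ring
  -- norms
  have hP₁n : ‖P₁‖ = p c * ‖𝓕 g₁ β‖ := by
    rw [hP₁, norm_mul, Complex.norm_real, Real.norm_of_nonneg hp0]
  have hQn : ‖Q‖ = p c * ‖𝓕 g₂c β‖ := by
    rw [hQ, norm_mul, Complex.norm_real, Real.norm_of_nonneg hp0, Complex.norm_conj]
  have hW0 : 0 ≤ W := (norm_nonneg _).trans (hW1 0)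
  have hS₁ : ∑' m, ‖Φ₁ m‖ ≤ M := hΦ₁le
  have hS₂ : ∑' m, ‖Φ₂ m‖ ≤ M := hΦ₂le
  have hS₁0 : 0 ≤ ∑' m, ‖Φ₁ m‖ := tsum_nonneg fun _ ↦ norm_nonneg _
  have hS₂0 : 0 ≤ ∑' m, ‖Φ₂ m‖ := tsum_nonneg fun _ ↦ norm_nonneg _
  have hA0 : 0 ≤ A / c := hp0.trans hpA
  rw [hdiff, norm_mul, norm_fourierChar_eq, one_mul]
  calc ‖P₁ * ∑ d ∈ I, w d * conj (T₂ d) + Q * ∑ d ∈ I, w d * T₁ d +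
          ∑ d ∈ I, w d * (T₁ d * conj (T₂ d))‖
      ≤ ‖P₁‖ * ‖∑ d ∈ I, w d * conj (T₂ d)‖ + ‖Q‖ * ‖∑ d ∈ I, w d * T₁ d‖ +
          ‖∑ d ∈ I, w d * (T₁ d * conj (T₂ d))‖ := by
        refine (norm_add_le _ _).trans (add_le_add ((norm_add_le _ _).trans (add_le_add ?_ ?_)) le_rfl)
        · rw [norm_mul]
        · rw [norm_mul]
    _ ≤ (p c * ‖𝓕 g₁ β‖) * ((∑' m, ‖Φ₂ m‖) * W) + (p c * ‖𝓕 g₂c β‖) * ((∑' m, ‖Φ₁ m‖) * W) +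
          (∑' m, ‖Φ₁ m‖) * (∑' n, ‖Φ₂ n‖) * W := by
        rw [hP₁n, hQn]
        gcongr
    _ ≤ (A / c * ‖𝓕 g₁ β‖) * (M * W) + (A / c * ‖𝓕 g₂c β‖) * (M * W) + M * M * W := by
        have h1 : p c * ‖𝓕 g₁ β‖ ≤ A / c * ‖𝓕 g₁ β‖ :=
          mul_le_mul_of_nonneg_right hpA (norm_nonneg _)
        have h2 : p c * ‖𝓕 g₂c β‖ ≤ A / c * ‖𝓕 g₂c β‖ :=
          mul_le_mul_of_nonneg_right hpA (norm_nonneg _)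
        have h3 : (∑' m, ‖Φ₂ m‖) * W ≤ M * W := mul_le_mul_of_nonneg_right hS₂ hW0
        have h4 : (∑' m, ‖Φ₁ m‖) * W ≤ M * W := mul_le_mul_of_nonneg_right hS₁ hW0
        have h5 : (∑' m, ‖Φ₁ m‖) * (∑' n, ‖Φ₂ n‖) * W ≤ M * M * W :=
          mul_le_mul_of_nonneg_right (mul_le_mul hS₁ hS₂ hS₂0 hM0) hW0
        exact add_le_add (add_le_add
          (mul_le_mul h1 h3 (mul_nonneg hS₂0 hW0) (mul_nonneg hA0 (norm_nonneg _)))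
          (mul_le_mul h2 h4 (mul_nonneg hS₁0 hW0) (mul_nonneg hA0 (norm_nonneg _)))) h5
    _ = W * ((A / c) * (‖𝓕 g₁ β‖ + ‖𝓕 g₂c β‖) * M + M ^ 2) := by ring

end CircleMethod

end ConreyIwaniec2002

end Literature.NumberTheory.LFunctions

end
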